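import Mathlib
import Literature.Computability.Complexity.ClosedFamilies

/-!
# Stub `stub_cardSmallSupport` (B1b) of crux `FermionicNormalForm`, line `registered`

Crux `Summit.ValiantsHypothesis.ValiantsHypothesis.Theses.TwistedDetRank.FermionicNormalForm`
(item `stmt-ValiantsHypothesis-6283`), line `registered`
(= `Cruxes/FermionicNormalForm/Lines/birth.lean`), stub `stub_cardSmallSupport` (B1b):
at most `(n+1)^w` permutations of `Fin n` move at most `w` points.
This is the count that makes the perturbative end of the local-generator construction
(one twisted determinant per permutation `π` with `#supp π ≤ w`) quasi-polynomial.

Proof: `#{π : #supp π ≤ w} ≤ Σ_{k ≤ w} Σ_{S ⊆ Fin n, #S = k} #{π : supp π ⊆ S}`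
`≤ Σ_{k ≤ w} C(n,k) · k! = Σ_{k ≤ w} n.descFactorial k ≤ Σ_{k ≤ w} n^k ≤ (n+1)^w`,
where `#{π : supp π ⊆ S} ≤ (#S)!` because such `π` lie in the image of
`Equiv.Perm.ofSubtype : Perm S → Perm (Fin n)` (`Equiv.Perm.ofSubtype_subtypePerm`).
-/

-- single-conjunct layout: Sub = Summit, duplicated namespace component intended
set_option linter.dupNamespace false

namespace Summit.ValiantsHypothesis.ValiantsHypothesis.Theorems.TwistedDetRankFermionicNormalForm

open Finset

/-- Permutations of `Fin n` with support inside `S` lie in the image of `Perm S`, so there are at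
most `(#S)!` of them. -/
theorem card_filter_support_subset_le_factorial (n : ℕ) (S : Finset (Fin n)) :
    (univ.filter fun π : Equiv.Perm (Fin n) => π.support ⊆ S).card ≤ (S.card).factorial := by
  have hsub : (univ.filter fun π : Equiv.Perm (Fin n) => π.support ⊆ S) ⊆
      (univ : Finset (Equiv.Perm {x // x ∈ S})).image Equiv.Perm.ofSubtype := by
    intro π hπ
    have hS : π.support ⊆ S := (mem_filter.mp hπ).2
    have h₁ : ∀ x, π x ∈ S ↔ x ∈ S := by
      intro x
      by_cases hx : x ∈ π.support
      · exact ⟨fun _ => hS hx, fun _ => hS (Equiv.Perm.apply_mem_support.mpr hx)⟩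
      · rw [Equiv.Perm.notMem_support.mp hx]
    have h₂ : ∀ x, π x ≠ x → x ∈ S := fun x hx => hS (Equiv.Perm.mem_support.mpr hx)
    exact mem_image.mpr ⟨π.subtypePerm h₁, mem_univ _, Equiv.Perm.ofSubtype_subtypePerm h₁ h₂⟩
  calc (univ.filter fun π : Equiv.Perm (Fin n) => π.support ⊆ S).card
      ≤ ((univ : Finset (Equiv.Perm {x // x ∈ S})).image Equiv.Perm.ofSubtype).card :=
        card_le_card hsub
    _ ≤ (univ : Finset (Equiv.Perm {x // x ∈ S})).card := card_image_le
    _ = (S.card).factorial := by rw [card_univ, Fintype.card_perm, Fintype.card_coe]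

/-- Stub B1b: at most `(n+1)^w` permutations of `Fin n` move at most `w` points
(`#{π ∈ S_n : #supp π ≤ w} ≤ Σ_{k ≤ w} C(n,k)·k! ≤ Σ_{k ≤ w} n^k ≤ (n+1)^w`). -/
theorem stub_cardSmallSupport :
    ∀ (n w : ℕ),
      (Finset.univ.filter fun π : Equiv.Perm (Fin n) => π.support.card ≤ w).card ≤ (n + 1) ^ w := by
  intro n w
  -- cover `{π : #supp π ≤ w}` by the sets `{π : supp π ⊆ S}` over `S ⊆ Fin n` with `#S = k ≤ w`
  have hcover : (univ.filter fun π : Equiv.Perm (Fin n) => π.support.card ≤ w) ⊆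
      (range (w + 1)).biUnion fun k =>
        (powersetCard k (univ : Finset (Fin n))).biUnion fun S =>
          univ.filter fun π : Equiv.Perm (Fin n) => π.support ⊆ S := by
    intro π hπ
    rw [mem_biUnion]
    refine ⟨π.support.card, mem_range.mpr (Nat.lt_succ_of_le (mem_filter.mp hπ).2), ?_⟩
    rw [mem_biUnion]
    exact ⟨π.support, mem_powersetCard.mpr ⟨subset_univ _, rfl⟩,
      mem_filter.mpr ⟨mem_univ _, Subset.rfl⟩⟩
  calc (univ.filter fun π : Equiv.Perm (Fin n) => π.support.card ≤ w).card
      ≤ ((range (w + 1)).biUnion fun k =>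
          (powersetCard k (univ : Finset (Fin n))).biUnion fun S =>
            univ.filter fun π : Equiv.Perm (Fin n) => π.support ⊆ S).card := card_le_card hcover
    _ ≤ ∑ k ∈ range (w + 1), ((powersetCard k (univ : Finset (Fin n))).biUnion fun S =>
          univ.filter fun π : Equiv.Perm (Fin n) => π.support ⊆ S).card := card_biUnion_le
    _ ≤ ∑ k ∈ range (w + 1), ∑ S ∈ powersetCard k (univ : Finset (Fin n)),
          (univ.filter fun π : Equiv.Perm (Fin n) => π.support ⊆ S).card :=
        sum_le_sum fun _ _ => card_biUnion_le
    _ ≤ ∑ k ∈ range (w + 1), ∑ S ∈ powersetCard k (univ : Finset (Fin n)), k.factorial := by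
        refine sum_le_sum fun k _ => sum_le_sum fun S hS => ?_
        rw [← (mem_powersetCard.mp hS).2]
        exact card_filter_support_subset_le_factorial n S
    _ = ∑ k ∈ range (w + 1), n.descFactorial k := by
        refine sum_congr rfl fun k _ => ?_
        rw [sum_const, card_powersetCard, card_univ, Fintype.card_fin, smul_eq_mul,
          Nat.descFactorial_eq_factorial_mul_choose, mul_comm]
    _ ≤ ∑ k ∈ range (w + 1), n ^ k := sum_le_sum fun k _ => Nat.descFactorial_le_pow n k
    _ ≤ (n + 1) ^ w := Literature.Computability.Complexity.Razborov.sum_range_pow_le_succ_pow n w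

end Summit.ValiantsHypothesis.ValiantsHypothesis.Theorems.TwistedDetRankFermionicNormalForm
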